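import Mathlib.LinearAlgebra.Matrix.Charpoly.Basic
import Literature.NumberTheory.Rogawski1990.StableConjugacyU3
import Literature.NumberTheory.Automorphic.UnitaryGroupDirectSum
import HarnessLib

/-!
# The eigenvalue pair of a singular frame is a STABLE invariant (Rogawski 1990, §3.8 Prop. 3.8.1; §3.1)

Topic `NumberTheory/Rogawski1990`; namespace `Literature.NumberTheory.Rogawski1990`.  THEOREMS ONLY (no definition, no instance, no
named fact, no `sorry`).  Companion of ★ `SingularSemisimpleElement.exists_singular_frame_of_anisotropic` (which PRODUCES a frame
`γ P = P (a·1₂ ⊕ᶠ b·1₁)`, `a ≠ b`, of a singular non-central semisimple `γ ∈ U_σ(H)(K)`) and of ★ `StableConjugacyU3.IsStablyConj.charpoly_eq`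
(stably conjugate elements have the same characteristic polynomial): here we record that the ORDERED pair `(a, b)` of a frame — `a` the
double eigenvalue, `b` the simple one — is read off the characteristic polynomial, hence is the SAME for the frames of any two stably
conjugate (or corresponding, across two hermitian forms) singular elements.  This is the algebraic half of «the centralizers `Z_c ≃ U(W₂) × U(W₁)`,
`W₂ = ker(c − a)`, `W₁ = ker(c − b)`, of stably conjugate singular `c, c′` have the same block type with the same scalars» used when the
covolumes ∕ Tamagawa numbers of `Z_c` and `Z_{c′}` are compared [Rogawski1990, §14.5 Lemma 14.5.2 (b) p. 239].

* §1 (any commutative ring) `charpoly_smul_one_eq_pow` «`χ_{a·1_N} = (X − a)^N`», `charpoly_finSum` «`χ_{B ⊕ᶠ C} = χ_B · χ_C`»,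
  `charpoly_finSum_smul_one` «`χ_{a·1 ⊕ᶠ b·1} = (X − a)^{N₁} (X − b)^{N₂}`», **`charpoly_eq_of_frame`** «`γ P = P (a·1 ⊕ᶠ b·1)`, `P`
  invertible ⇒ `χ_γ = (X − a)^{N₁} (X − b)^{N₂}`».
* §2 (domain) **`eq_and_eq_of_X_sub_C_sq_mul_eq`** «`(X − a)²(X − b) = (X − a₂)²(X − b₂)`, `a ≠ b`, `a₂ ≠ b₂` ⇒ `a = a₂ ∧ b = b₂`» (as
  POLYNOMIALS — over a finite field the two sides may agree as functions), and the `3 × 3` frame consequences **`frame_pair_eq_of_charpoly_eq`**,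
  **`IsStablyConj.frame_pair_eq`**, **`Corresponds.frame_pair_eq`**, **`frame_pair_eq_of_ofConjClass_eq`** (the last in the
  `StableClass.ofConjClass c = StableClass.ofConjClass c′` ∕ `Quotient.out` currency of the adelic covolume letters).

## References
* J. Rogawski, *Automorphic Representations of Unitary Groups in Three Variables*, Ann. of Math. Stud. 123 (1990), §3.8 «Singular
  semisimple elements», Prop. 3.8.1 p. 30 (the frame and its eigenvalues `{a, a, b}`); §3.1 p. 19 (stable conjugacy = `GL₃`-conjugacy
  preserves the characteristic polynomial); §14.5 Lemma 14.5.2 (b) p. 239 (use: comparing the centralizers of stably conjugate singular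
  elements) [Rogawski1990].
-/

noncomputable section

namespace Literature.NumberTheory.Rogawski1990

open scoped MatrixGroups
open Matrix Polynomial
open Literature.AlgebraicGeometry.ShimuraVarieties (unitaryGroup)
open Literature.NumberTheory.Automorphic.UnitaryGroup (finSum)

/-! ## §1 The characteristic polynomial of a framed matrix -/

section CommRing

variable {S : Type*} [CommRing S] {N₁ N₂ : ℕ}

/-- `χ_{a·1_N} = (X − a)^N`. [cite: Rogawski1990, §3.8 Prop. 3.8.1 p. 30] -/
theorem charpoly_smul_one_eq_pow (N : ℕ) (a : S) :
    (a • (1 : Matrix (Fin N) (Fin N) S)).charpoly = (X - C a) ^ N := by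
  rw [smul_one_eq_diagonal, Matrix.charpoly_diagonal, Finset.prod_const, Finset.card_univ, Fintype.card_fin]

/-- `χ_{B ⊕ᶠ C} = χ_B · χ_C` for the `Fin`-indexed direct sum ★ `finSum`. [cite: Rogawski1990, §3.8 Prop. 3.8.1 p. 30] -/
theorem charpoly_finSum (B : Matrix (Fin N₁) (Fin N₁) S) (D : Matrix (Fin N₂) (Fin N₂) S) :
    (finSum N₁ N₂ B D).charpoly = B.charpoly * D.charpoly := by
  rw [finSum, Matrix.charpoly_reindex, Matrix.charpoly_fromBlocks_zero₁₂]

/-- `χ_{a·1_{N₁} ⊕ᶠ b·1_{N₂}} = (X − a)^{N₁} (X − b)^{N₂}`. [cite: Rogawski1990, §3.8 Prop. 3.8.1 p. 30] -/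
theorem charpoly_finSum_smul_one (a b : S) :
    (finSum N₁ N₂ (a • (1 : Matrix (Fin N₁) (Fin N₁) S)) (b • (1 : Matrix (Fin N₂) (Fin N₂) S))).charpoly =
      (X - C a) ^ N₁ * (X - C b) ^ N₂ := by
  rw [charpoly_finSum, charpoly_smul_one_eq_pow, charpoly_smul_one_eq_pow]

/-- **The characteristic polynomial of a framed matrix**: if `γ P = P (a·1_{N₁} ⊕ᶠ b·1_{N₂})` with `P` invertible, then
`χ_γ = (X − a)^{N₁} (X − b)^{N₂}` — the eigenvalues of a singular `γ` with frame `(a, b, P)` are `{a, …, a, b, …, b}`.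
[cite: Rogawski1990, §3.8 Prop. 3.8.1 p. 30] -/
theorem charpoly_eq_of_frame {γ : Matrix (Fin (N₁ + N₂)) (Fin (N₁ + N₂)) S} {P : GL (Fin (N₁ + N₂)) S} {a b : S}
    (hγP : γ * (P : Matrix (Fin (N₁ + N₂)) (Fin (N₁ + N₂)) S) =
      (P : Matrix (Fin (N₁ + N₂)) (Fin (N₁ + N₂)) S) *
        finSum N₁ N₂ (a • (1 : Matrix (Fin N₁) (Fin N₁) S)) (b • (1 : Matrix (Fin N₂) (Fin N₂) S))) :
    γ.charpoly = (X - C a) ^ N₁ * (X - C b) ^ N₂ := by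
  have hconj : γ = (P : Matrix (Fin (N₁ + N₂)) (Fin (N₁ + N₂)) S) *
      finSum N₁ N₂ (a • (1 : Matrix (Fin N₁) (Fin N₁) S)) (b • (1 : Matrix (Fin N₂) (Fin N₂) S)) *
        ((P⁻¹ : GL (Fin (N₁ + N₂)) S) : Matrix (Fin (N₁ + N₂)) (Fin (N₁ + N₂)) S) := by
    rw [← hγP, Matrix.mul_assoc, ← Units.val_mul, mul_inv_cancel, Units.val_one, Matrix.mul_one]
  rw [hconj, Matrix.coe_units_inv, Matrix.charpoly_units_conj, charpoly_finSum_smul_one]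

end CommRing

/-! ## §2 The ordered pair `(a, b)` of a `3 × 3` singular frame is a stable invariant -/

section Domain

variable {K : Type*} [CommRing K] [IsDomain K]

/-- **`(X − a)²(X − b) = (X − a₂)²(X − b₂)` with `a ≠ b`, `a₂ ≠ b₂` forces `a = a₂` and `b = b₂`** (an identity of POLYNOMIALS over a
domain: evaluation at `a`, `a₂`, `b` leaves only the swapped case `(a₂, b₂) = (b, a)`, which cancelling `(X − a)(X − b)` reduces to
`a = b`).  [cite: Rogawski1990, §3.8 Prop. 3.8.1 p. 30] -/
theorem eq_and_eq_of_X_sub_C_sq_mul_eq {a b a₂ b₂ : K} (hab : a ≠ b) (hab₂ : a₂ ≠ b₂)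
    (h : (X - C a) ^ 2 * (X - C b) = (X - C a₂) ^ 2 * (X - C b₂)) : a = a₂ ∧ b = b₂ := by
  have key : ∀ x : K, (x - a) ^ 2 * (x - b) = (x - a₂) ^ 2 * (x - b₂) := fun x => by
    simpa only [eval_mul, eval_pow, eval_sub, eval_X, eval_C] using congrArg (Polynomial.eval x) h
  have root_of : ∀ {x : K}, (x - a₂) ^ 2 * (x - b₂) = 0 → x = a₂ ∨ x = b₂ := fun {x} hx => by
    rcases mul_eq_zero.1 hx with h1 | h1
    · exact Or.inl (sub_eq_zero.1 (pow_eq_zero_iff two_ne_zero |>.1 h1))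
    · exact Or.inr (sub_eq_zero.1 h1)
  -- `a` and `b` are roots of the right-hand side
  have ha : a = a₂ ∨ a = b₂ := root_of (by rw [← key a, sub_self, zero_pow two_ne_zero, zero_mul])
  have hb : b = a₂ ∨ b = b₂ := root_of (by rw [← key b, sub_self, mul_zero])
  -- `a₂` is a root of the left-hand side
  have ha₂ : a₂ = a ∨ a₂ = b := by
    have h0 : (a₂ - a) ^ 2 * (a₂ - b) = 0 := by rw [key a₂, sub_self, zero_pow two_ne_zero, zero_mul]
    rcases mul_eq_zero.1 h0 with h1 | h1
    · exact Or.inl (sub_eq_zero.1 (pow_eq_zero_iff two_ne_zero |>.1 h1))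
    · exact Or.inr (sub_eq_zero.1 h1)
  rcases ha with ha | ha
  · -- `a = a₂`: then `b = b₂` (else `b = a₂ = a`)
    refine ⟨ha, ?_⟩
    rcases hb with hb | hb
    · exact absurd (hb.trans ha.symm) (Ne.symm hab)
    · exact hb
  · -- `a = b₂`, `a ≠ a₂`: then `a₂ = b`, the swapped case, contradicted by cancellation
    exfalso
    have ha₂b : a₂ = b := by
      rcases ha₂ with h1 | h1
      · exact absurd h1.symm (fun h2 => hab₂ (h2.symm.trans ha) |>.elim)
      · exact h1
    -- now `a₂ = b`, `b₂ = a` and `h : (X − a)²(X − b) = (X − b)²(X − a)`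
    have h' : (X - C a) * (X - C b) * (X - C a) = (X - C a) * (X - C b) * (X - C b) := by
      calc (X - C a) * (X - C b) * (X - C a) = (X - C a) ^ 2 * (X - C b) := by ring
        _ = (X - C b) ^ 2 * (X - C a) := by rw [h, ha₂b, ← ha]
        _ = (X - C a) * (X - C b) * (X - C b) := by ring
    have hne : (X - C a) * (X - C b) ≠ 0 := mul_ne_zero (X_sub_C_ne_zero a) (X_sub_C_ne_zero b)
    have hab' : (X - C a : K[X]) = X - C b := mul_left_cancel₀ hne h'
    exact hab (C_injective (sub_right_injective hab'))

/-- **Two framed `3 × 3` matrices with the same characteristic polynomial have the same ORDERED frame pair**: if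
`γ P = P (a·1₂ ⊕ᶠ b·1₁)`, `δ Q = Q (a₂·1₂ ⊕ᶠ b₂·1₁)` with `a ≠ b`, `a₂ ≠ b₂` and `χ_γ = χ_δ`, then `a = a₂` and `b = b₂`.
[cite: Rogawski1990, §3.8 Prop. 3.8.1 p. 30] -/
theorem frame_pair_eq_of_charpoly_eq {γ δ : Matrix (Fin 3) (Fin 3) K} {P Q : GL (Fin 3) K} {a b a₂ b₂ : K}
    (hab : a ≠ b) (hab₂ : a₂ ≠ b₂)
    (hγP : γ * (P : Matrix (Fin 3) (Fin 3) K) =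
      (P : Matrix (Fin 3) (Fin 3) K) * finSum 2 1 (a • (1 : Matrix (Fin 2) (Fin 2) K)) (b • (1 : Matrix (Fin 1) (Fin 1) K)))
    (hδQ : δ * (Q : Matrix (Fin 3) (Fin 3) K) =
      (Q : Matrix (Fin 3) (Fin 3) K) * finSum 2 1 (a₂ • (1 : Matrix (Fin 2) (Fin 2) K)) (b₂ • (1 : Matrix (Fin 1) (Fin 1) K)))
    (hχ : γ.charpoly = δ.charpoly) : a = a₂ ∧ b = b₂ := by
  have h1 := charpoly_eq_of_frame (N₁ := 2) (N₂ := 1) hγP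
  have h2 := charpoly_eq_of_frame (N₁ := 2) (N₂ := 1) hδQ
  rw [pow_one] at h1 h2
  exact eq_and_eq_of_X_sub_C_sq_mul_eq hab hab₂ (h1.symm.trans (hχ.trans h2))

variable {σ : K →+* K} {H H' : Matrix (Fin 3) (Fin 3) K}

/-- **Stably conjugate singular elements have the same frame pair**: for `γ ∼_st δ` in `U_σ(H)(K)` with frames `γ P = P (a·1₂ ⊕ᶠ b·1₁)`,
`δ Q = Q (a₂·1₂ ⊕ᶠ b₂·1₁)` (`a ≠ b`, `a₂ ≠ b₂`, e.g. from ★ `exists_singular_frame_of_anisotropic`), `a = a₂` and `b = b₂` — so the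
centralizers `U(ker(γ − a)) × U(ker(γ − b))` and `U(ker(δ − a)) × U(ker(δ − b))` are cut out by the SAME scalars.
[cite: Rogawski1990, §3.1 p. 19; §3.8 Prop. 3.8.1 p. 30] -/
theorem IsStablyConj.frame_pair_eq {γ δ : unitaryGroup σ H} (hst : IsStablyConj σ H γ δ) {P Q : GL (Fin 3) K} {a b a₂ b₂ : K}
    (hab : a ≠ b) (hab₂ : a₂ ≠ b₂)
    (hγP : ((γ : GL (Fin 3) K) : Matrix (Fin 3) (Fin 3) K) * (P : Matrix (Fin 3) (Fin 3) K) =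
      (P : Matrix (Fin 3) (Fin 3) K) * finSum 2 1 (a • (1 : Matrix (Fin 2) (Fin 2) K)) (b • (1 : Matrix (Fin 1) (Fin 1) K)))
    (hδQ : ((δ : GL (Fin 3) K) : Matrix (Fin 3) (Fin 3) K) * (Q : Matrix (Fin 3) (Fin 3) K) =
      (Q : Matrix (Fin 3) (Fin 3) K) * finSum 2 1 (a₂ • (1 : Matrix (Fin 2) (Fin 2) K)) (b₂ • (1 : Matrix (Fin 1) (Fin 1) K))) :
    a = a₂ ∧ b = b₂ :=
  frame_pair_eq_of_charpoly_eq hab hab₂ hγP hδQ hst.charpoly_eq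

/-- **Corresponding singular elements (`γ′ ↔ γ` across two hermitian forms `H′, H`) have the same frame pair.**
[cite: Rogawski1990, §14.1 p. 232; §3.8 Prop. 3.8.1 p. 30] -/
theorem Corresponds.frame_pair_eq {γ' : unitaryGroup σ H'} {γ : unitaryGroup σ H} (hc : Corresponds σ H' H γ' γ)
    {P' P : GL (Fin 3) K} {a' b' a b : K} (hab' : a' ≠ b') (hab : a ≠ b)
    (hγP' : ((γ' : GL (Fin 3) K) : Matrix (Fin 3) (Fin 3) K) * (P' : Matrix (Fin 3) (Fin 3) K) =
      (P' : Matrix (Fin 3) (Fin 3) K) * finSum 2 1 (a' • (1 : Matrix (Fin 2) (Fin 2) K)) (b' • (1 : Matrix (Fin 1) (Fin 1) K)))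
    (hγP : ((γ : GL (Fin 3) K) : Matrix (Fin 3) (Fin 3) K) * (P : Matrix (Fin 3) (Fin 3) K) =
      (P : Matrix (Fin 3) (Fin 3) K) * finSum 2 1 (a • (1 : Matrix (Fin 2) (Fin 2) K)) (b • (1 : Matrix (Fin 1) (Fin 1) K))) :
    a' = a ∧ b' = b :=
  frame_pair_eq_of_charpoly_eq hab' hab hγP' hγP hc.charpoly_eq

/-- **The same in the currency of the adelic letters**: if the conjugacy classes `c, c′` of `U_σ(H)(K)` lie in ONE stable class
(`StableClass.ofConjClass c = StableClass.ofConjClass c′`), frames of their chosen representatives `Quotient.out c`, `Quotient.out c′`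
have the same ordered pair. [cite: Rogawski1990, §3.1 p. 19; §3.8 Prop. 3.8.1 p. 30] -/
theorem frame_pair_eq_of_ofConjClass_eq {c c' : ConjClasses (unitaryGroup σ H)}
    (hst : StableClass.ofConjClass c = StableClass.ofConjClass c') {P Q : GL (Fin 3) K} {a b a₂ b₂ : K}
    (hab : a ≠ b) (hab₂ : a₂ ≠ b₂)
    (hγP : (((Quotient.out c : unitaryGroup σ H) : GL (Fin 3) K) : Matrix (Fin 3) (Fin 3) K) * (P : Matrix (Fin 3) (Fin 3) K) =
      (P : Matrix (Fin 3) (Fin 3) K) * finSum 2 1 (a • (1 : Matrix (Fin 2) (Fin 2) K)) (b • (1 : Matrix (Fin 1) (Fin 1) K)))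
    (hδQ : (((Quotient.out c' : unitaryGroup σ H) : GL (Fin 3) K) : Matrix (Fin 3) (Fin 3) K) * (Q : Matrix (Fin 3) (Fin 3) K) =
      (Q : Matrix (Fin 3) (Fin 3) K) * finSum 2 1 (a₂ • (1 : Matrix (Fin 2) (Fin 2) K)) (b₂ • (1 : Matrix (Fin 1) (Fin 1) K))) :
    a = a₂ ∧ b = b₂ := by
  have hst' : IsStablyConj σ H (Quotient.out c) (Quotient.out c') := by
    rw [← Quotient.out_eq c, ← Quotient.out_eq c'] at hst
    exact stableClassOf_eq_iff.mp hst
  exact hst'.frame_pair_eq hab hab₂ hγP hδQ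

end Domain

end Literature.NumberTheory.Rogawski1990
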